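import Mathlib
import HarnessLib
import Literature.Analysis.FluidPDE.SelfSimilar
import Literature.Analysis.FluidPDE.TypeIAncientMild
import Summits.NavierStokesRegularity.NavierStokesRegularity.Theorems.QuarterLogPincerTruncationEdgeDefs
import Summits.NavierStokesRegularity.NavierStokesRegularity.Theorems.QuarterLogPincerQuietCollarDefs
import Summits.NavierStokesRegularity.NavierStokesRegularity.Theorems.QuarterLogPincerQuietCollarSpikeTools

/-!
# Route `QuarterLogPincer`, crux `TypeIQuantSubcubicExp` (stmt-NavierStokesRegularity-24077), line `quiet_collar` —
  QP1 BY NAME: `stub_quietCollar : StubQuietCollar` (THE LEVER — a quiet collar at polynomial radius)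

The registered-form obligation QP1 of ns-idea-7 g9's LOOP line `quiet_collar` v1.1 (`Cruxes/TypeIQuantSubcubicExp/Lines/
quiet_collar.lean`, tree sha16 `8170489f8bcaaff9`; critic of record idea-crit-4 g6, v1.0 PASS no price 2026-08-28T22:42:30Z
with note N3 «state the collar lemma as its own M-size item first»; DIRECTOR-NS dss_121 key (B) to the pub-ns-dss typer
g36), proved against the re-homed objects `QuietCollar` / `StubQuietCollar` of `Theorems/QuarterLogPincerQuietCollarDefs.lean`
(bodies verbatim = the line's), so that the line can import it and delete its `sorry`:

  `StubQuietCollar := ∀ M v, IsTypeIAncientMild M v → EnvelopeCubeBudget v → QuietCollar v`,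
  `QuietCollar v := ∀ k K, 0 ≤ k → 1 ≤ K → ∃ κ₁ K₁, 0 ≤ κ₁ ∧ 2 ≤ K₁ ∧ ∀ ε ∈ (0,1/2], ∀ ηq Lq, εᵏ/K ≤ ηq → 0 < Lq →
     Lq ≤ Kε^{−k} → ∃ r, 2 ≤ r ∧ r + Lq ≤ K₁ε^{−κ₁} ∧ ∀ s ∈ [−1,−ε], ∀ x, r ≤ |x| ≤ r + Lq → ‖v s x‖ ≤ ηq`.

ROAD (the line docstring's spike counting; Chebyshev–Fubini over the radius instead of Vitali; tools in
`…QuietCollarSpikeTools`):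
* §5 `exists_quietCollar_of_key` — at fixed `ε, η, L, ρ`: if `(L+2a)·B·(1+log R+log(2/ε)) < μρ` (`a = ηε²/(4D₀)` the
  margin, `μ = (η/2)³a⁴|B₁|` the box mass, `R = 2ρ+L+a+1`, `B` the budget constant, `D₀` the slab Lipschitz constant),
  then some `r ∈ [ρ,2ρ]` carries a collar of width `L` quiet at level `η` at ALL times of `[−1,−ε]`: the cube density of
  `[−1,−ε/2] × B(0,R)` has mass `≤ B(1+log R+log(2/ε))` (§4 + the budget at `ε/2`), so by §3 some thickened shell has
  mass `≤ ((L+2a)/ρ)·that < μ`, while a spike in its collar would put a box of mass `≥ μ` (§2) inside it.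
* §6 `stub_quietCollar` — the polynomial bookkeeping: quietness `η₀ = εᵏ/K`, width `L₀ = Kε^{−k}`, base radius
  `ρ = (21L₀(B+1)/(εμ))² + L₀ + 2`; `1 + log R + log(2/ε) ≤ 7√ρ/ε` (`log x ≤ 2√x`) and `21L₀B/(εμ) < √ρ` give the key
  inequality; `r + Lq ≤ 3ρ ≤ K₁ε^{−κ₁}` with `κ₁ = 16k + 18`, `K₁ = 3((43008(B+1)D₀⁴K⁸/|B₁|)² + K + 2)`.

With QP1 landed, the line's Q1 anatomy `farFieldTruncation_of_quietAnatomy : QP1 → QP2 → QP3 → P2 → FarFieldTruncation M v`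
has QP2 (cut pair) and QP3 (forced two-norm shadowing) open; P2 is the landed `TruncationEdge.stub_frameBootstrap`.
HONEST FRAMING: a covering lemma about HYPOTHETICAL Type-I ancient mild fields with a log-shaped cube budget; QP1 alone
moves nothing on 24077 (CAPPED, T2), on the envelope-class Liouville wall (22144/10661) or on the DSS wall W7; QP2, QP3,
Q2, Q3, 24077, 22144 and Navier–Stokes regularity are OPEN / not proved.
-/

noncomputable section

-- the summit-side namespace repeats a component by design (D-0017)
set_option linter.dupNamespace false

namespace Summit.NavierStokesRegularity.NavierStokesRegularity.Cruxes.TypeIQuantSubcubicExp.QuietCollar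

open MeasureTheory Set Function Metric Filter Topology
open scoped ENNReal NNReal
open Literature.Analysis Literature.Analysis.FluidPDE
open Summit.NavierStokesRegularity.NavierStokesRegularity.Cruxes.TypeIQuantSubcubicExp.TruncationEdge
  (EnvelopeCubeBudget)

/-! ### 5. A quiet collar at every radius beating the budget -/

/-- **Quiet collar at fixed data.**  Type-I ancient mild field `v` with log-cube budget constant `B`, slab Lipschitz
constant `D₀/ε²` on `[−1,−ε/2]`; quietness target `0 < η ≤ 1`, width `L ≥ 1`, margin `a = ηε²/(4D₀)`, box mass
`μ = (η/2)³·a·a³·|B₁|`.  If the base radius `ρ ≥ L + 2` satisfies the KEY INEQUALITY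
`(L + 2a)·B·(1 + log(2ρ+L+a+1) + log(2/ε)) < μρ`, then some `r ∈ [ρ, 2ρ]` carries a collar `{r ≤ |x| ≤ r+L}` on
which `‖v(s,x)‖ ≤ η` for ALL `s ∈ [−1,−ε]` (radial averaging, §3, applied to the cube density; a spike would put
a box of mass `μ` — §2 — inside a thickened shell of mass `< μ`). -/
theorem exists_quietCollar_of_key {M : ℝ} {v : ℝ → EuclideanSpace ℝ (Fin 3) → EuclideanSpace ℝ (Fin 3)}
    (hv : IsTypeIAncientMild M v) {B : ℝ}
    (hbud : ∀ R : ℝ, 2 ≤ R → ∀ ε ∈ Set.Ioc (0 : ℝ) 1, ∃ b : ℝ, 0 ≤ b ∧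
      b ^ 3 ≤ B * (1 + Real.log R + Real.log (1 / ε)) ∧
      ∀ s ∈ Set.Icc (-1 : ℝ) (-ε),
        eLpNorm ((Metric.ball (0 : EuclideanSpace ℝ (Fin 3)) R).indicator (v s)) 3 volume ≤
          ENNReal.ofReal b)
    {D₀ ε η L ρ a μ : ℝ} (hD₀ : 1 ≤ D₀) (hε : 0 < ε) (hε1 : ε ≤ 1 / 2) (hη : 0 < η) (hη1 : η ≤ 1)
    (hL : 1 ≤ L) (hρ : L + 2 ≤ ρ)
    (hLx : ∀ s ∈ Set.Icc (-1 : ℝ) (-(ε / 2)), ∀ x y : EuclideanSpace ℝ (Fin 3),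
      ‖v s x - v s y‖ ≤ D₀ / ε ^ 2 * ‖x - y‖)
    (hLt : ∀ x : EuclideanSpace ℝ (Fin 3), ∀ s ∈ Set.Icc (-1 : ℝ) (-(ε / 2)),
      ∀ s' ∈ Set.Icc (-1 : ℝ) (-(ε / 2)), ‖v s x - v s' x‖ ≤ D₀ / ε ^ 2 * |s - s'|)
    (ha : a = η * ε ^ 2 / (4 * D₀))
    (hμ : μ = (η / 2) ^ 3 * (a * (a ^ 3 * volume.real (Metric.ball (0 : EuclideanSpace ℝ (Fin 3)) 1))))
    (hkey : (L + 2 * a) * (B * (1 + Real.log (2 * ρ + L + a + 1) + Real.log (2 / ε))) < μ * ρ) :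
    ∃ r : ℝ, ρ ≤ r ∧ r ≤ 2 * ρ ∧ ∀ s ∈ Set.Icc (-1 : ℝ) (-ε), ∀ x : EuclideanSpace ℝ (Fin 3),
      r ≤ ‖x‖ → ‖x‖ ≤ r + L → ‖v s x‖ ≤ η := by
  have hcont : ContinuousOn (uncurry v) (Iio (0 : ℝ) ×ˢ univ) := hv.1.continuousOn
  have hD : 0 < D₀ / ε ^ 2 := by positivity
  have ha0 : 0 < a := by rw [ha]; positivity
  have haD : a = η / (4 * (D₀ / ε ^ 2)) := by rw [ha]; field_simp
  have ha1 : a ≤ 1 := by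
    rw [ha, div_le_one (by positivity)]
    have : ε ^ 2 ≤ 1 := by nlinarith
    nlinarith
  have haε : a ≤ ε / 2 := by
    rw [ha, div_le_iff₀ (by positivity)]
    have h1 : η * ε ^ 2 ≤ ε ^ 2 := by nlinarith
    have h2 : ε ^ 2 ≤ ε / 2 * 4 := by nlinarith
    nlinarith
  have hρ0 : 0 < ρ := by linarith
  have hV : 0 < volume.real (Metric.ball (0 : EuclideanSpace ℝ (Fin 3)) 1) :=
    ENNReal.toReal_pos (measure_ball_pos volume _ one_pos).ne' measure_ball_lt_top.ne
  have hμ0 : 0 < μ := by rw [hμ]; positivity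
  -- the measurable cube density `G` (= `ofReal ‖v‖³` on the open past, `0` elsewhere)
  set U : Set (ℝ × EuclideanSpace ℝ (Fin 3)) := Iio (0 : ℝ) ×ˢ univ with hU
  have hUo : IsOpen U := isOpen_Iio.prod isOpen_univ
  set g : ℝ × EuclideanSpace ℝ (Fin 3) → ℝ≥0∞ := fun p => ENNReal.ofReal (‖v p.1 p.2‖ ^ 3) with hg
  have hgc : ContinuousOn g U := ENNReal.continuous_ofReal.comp_continuousOn ((hcont.norm).pow 3)
  set G : ℝ × EuclideanSpace ℝ (Fin 3) → ℝ≥0∞ := U.piecewise g (fun _ => 0) with hGdef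
  have hGm : Measurable G := hgc.measurable_piecewise continuousOn_const hUo.measurableSet
  have hGg : ∀ p ∈ U, G p = g p := fun p hp => Set.piecewise_eq_of_mem _ _ _ hp
  -- the budget on the slab `[−1,−ε/2] × B(0,R)`
  set I : Set ℝ := Set.Icc (-1 : ℝ) (-(ε / 2)) with hI
  set R : ℝ := 2 * ρ + L + a + 1 with hR
  have hR2 : 2 ≤ R := by rw [hR]; linarith
  obtain ⟨b, hb0, hb3, hbsl⟩ := hbud R hR2 (ε / 2) ⟨by positivity, by linarith⟩
  have hIU : I ×ˢ Metric.ball (0 : EuclideanSpace ℝ (Fin 3)) R ⊆ U :=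
    prod_mono (fun s hs => by simp only [mem_Iio]; linarith [hs.2]) (subset_univ _)
  have hslab : ∫⁻ p in I ×ˢ Metric.ball (0 : EuclideanSpace ℝ (Fin 3)) R, G p ≤
      ENNReal.ofReal (B * (1 + Real.log R + Real.log (2 / ε))) := by
    rw [setLIntegral_congr_fun (measurableSet_Icc.prod measurableSet_ball) fun p hp => hGg p (hIU hp)]
    have hbsl' : ∀ s ∈ Set.Icc (-1 : ℝ) (-(ε / 2)),
        eLpNorm ((Metric.ball (0 : EuclideanSpace ℝ (Fin 3)) R).indicator (v s)) 3 volume ≤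
          ENNReal.ofReal b := fun s hs => hbsl s hs
    refine (slabMass_le_of_slices hcont hε hb0 hbsl').trans (ENNReal.ofReal_le_ofReal ?_)
    rwa [one_div_div] at hb3
  -- radial averaging
  obtain ⟨r, hr, hΦ⟩ := exists_radius_shellMass_le hGm measurableSet_Icc hρ0 hslab
  refine ⟨r, hr.1, hr.2, ?_⟩
  -- no spike in the collar
  by_contra hcon
  push Not at hcon
  obtain ⟨s₀, hs₀, x₀, hx₀r, hx₀L, hspike⟩ := hcon
  have hbox := le_boxIntegral_of_spike hD hη haD haε hLx hLt hs₀ hspike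
  rw [← hμ] at hbox
  -- the box sits inside the thickened shell and inside the open past
  have hQU : Set.Icc s₀ (s₀ + a) ×ˢ Metric.closedBall x₀ a ⊆ U :=
    prod_mono (fun s hs => by simp only [mem_Iio]; linarith [hs.2, hs₀.2]) (subset_univ _)
  have hQS : Set.Icc s₀ (s₀ + a) ×ˢ Metric.closedBall x₀ a ⊆
      I ×ˢ {x : EuclideanSpace ℝ (Fin 3) | r - a ≤ ‖x‖ ∧ ‖x‖ ≤ r + L + a} := by
    refine prod_mono (fun s hs => ⟨by linarith [hs.1, hs₀.1], by linarith [hs.2, hs₀.2]⟩) fun x hx => ?_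
    rw [mem_closedBall, dist_eq_norm] at hx
    have h1 : ‖x‖ - ‖x₀‖ ≤ a := (norm_sub_norm_le x x₀).trans hx
    have h2 : ‖x₀‖ - ‖x‖ ≤ a := by
      have := norm_sub_norm_le x₀ x
      rw [norm_sub_rev] at this
      exact this.trans hx
    exact ⟨by linarith, by linarith⟩
  have hchain : ENNReal.ofReal μ ≤ ENNReal.ofReal ((L + 2 * a) / ρ) *
      ENNReal.ofReal (B * (1 + Real.log R + Real.log (2 / ε))) :=
    calc ENNReal.ofReal μ
        ≤ ∫⁻ p in Set.Icc s₀ (s₀ + a) ×ˢ Metric.closedBall x₀ a, g p := hbox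
      _ = ∫⁻ p in Set.Icc s₀ (s₀ + a) ×ˢ Metric.closedBall x₀ a, G p :=
          (setLIntegral_congr_fun (measurableSet_Icc.prod measurableSet_closedBall)
            fun p hp => hGg p (hQU hp)).symm
      _ ≤ ∫⁻ p in I ×ˢ {x : EuclideanSpace ℝ (Fin 3) | r - a ≤ ‖x‖ ∧ ‖x‖ ≤ r + L + a}, G p :=
          lintegral_mono_set hQS
      _ ≤ _ := hΦ
  rw [← ENNReal.ofReal_mul (by positivity)] at hchain
  have hlt : (L + 2 * a) / ρ * (B * (1 + Real.log R + Real.log (2 / ε))) < μ := by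
    rw [div_mul_eq_mul_div, div_lt_iff₀ hρ0]
    exact hkey
  exact absurd hchain (not_le.2 ((ENNReal.ofReal_lt_ofReal_iff hμ0).2 hlt))


/-! ### 6. QP1 BY NAME: the polynomial bookkeeping -/

/-- **QP1 — THE QUIET COLLAR (the lever of line `quiet_collar`), BY NAME.**  For a Type-I ancient mild field with
the log-shaped cube budget and every polynomial request `(k, K)`: with `κ₁ = 16k + 18` and an explicit `K₁` (from the
budget constant `B`, the slab Lipschitz constant `D₀` of §1, `K` and `|B₁|`), for every `ε ∈ (0, 1/2]`, every
quietness `ηq ≥ εᵏ/K` and width `0 < Lq ≤ Kε^{−k}` there is a collar `{r ≤ |x| ≤ r + Lq}`, `2 ≤ r`,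
`r + Lq ≤ K₁ε^{−κ₁}`, on which `‖v(s,x)‖ ≤ ηq` for all `s ∈ [−1,−ε]`.  Proof: §5 at quietness `η₀ = εᵏ/K`, width
`L₀ = Kε^{−k}` and base radius `ρ = (21L₀(B+1)/(εμ))² + L₀ + 2`, where the key inequality holds because
`1 + log R + log(2/ε) ≤ 7√ρ/ε` and `21 L₀ B/(εμ) < √ρ`. -/
theorem stub_quietCollar : StubQuietCollar := by
  intro M v hv hbud k K hk hK
  obtain ⟨B, hB, hbudB⟩ := hbud
  obtain ⟨D₀, hD₀, hLip⟩ := exists_slab_lipschitz hv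
  obtain ⟨V₁, hV₁⟩ : ∃ V₁ : ℝ, V₁ = volume.real (Metric.ball (0 : EuclideanSpace ℝ (Fin 3)) 1) := ⟨_, rfl⟩
  have hV : 0 < V₁ := by
    rw [hV₁]; exact ENNReal.toReal_pos (measure_ball_pos volume _ one_pos).ne' measure_ball_lt_top.ne
  -- the constants: `C₀ = 21·2048·(B+1)·D₀⁴·K⁸/|B₁|`, `K₁ = 3 (C₀² + K + 2)`, `κ₁ = 16k + 18`
  obtain ⟨C₀, hC₀⟩ : ∃ C₀ : ℝ, C₀ = 43008 * (B + 1) * D₀ ^ 4 * K ^ 8 / V₁ := ⟨_, rfl⟩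
  have hC₀0 : 0 < C₀ := by rw [hC₀]; positivity
  refine ⟨16 * k + 18, 3 * (C₀ ^ 2 + K + 2), by positivity, by nlinarith [sq_nonneg C₀], ?_⟩
  rintro ε ⟨hε, hε2⟩ ηq Lq hηq hLq hLqK
  have hε1 : ε ≤ 1 := by linarith
  have hK0 : 0 < K := by linarith
  -- the request at its extreme values `η₀ = εᵏ/K`, `L₀ = K ε^{-k} = K/εᵏ`
  obtain ⟨t, ht⟩ : ∃ t : ℝ, t = ε ^ k := ⟨_, rfl⟩
  have ht0 : 0 < t := by rw [ht]; exact Real.rpow_pos_of_pos hε k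
  have ht1 : t ≤ 1 := by rw [ht]; exact Real.rpow_le_one hε.le hε1 hk
  have hεk : ε ^ (-k) = t⁻¹ := by rw [Real.rpow_neg hε.le, ht]
  obtain ⟨η₀, hη₀⟩ : ∃ η₀ : ℝ, η₀ = t / K := ⟨_, rfl⟩
  obtain ⟨L₀, hL₀⟩ : ∃ L₀ : ℝ, L₀ = K / t := ⟨_, rfl⟩
  have hη₀0 : 0 < η₀ := by rw [hη₀]; positivity
  have hη₀1 : η₀ ≤ 1 := by rw [hη₀, div_le_one hK0]; linarith
  have hL₀1 : 1 ≤ L₀ := by rw [hL₀, one_le_div ht0]; linarith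
  have hL₀0 : 0 < L₀ := by linarith
  have hLqL₀ : Lq ≤ L₀ := by rw [hL₀, div_eq_mul_inv, ← hεk]; exact hLqK
  -- margin, box mass, base radius
  obtain ⟨a, ha⟩ : ∃ a : ℝ, a = η₀ * ε ^ 2 / (4 * D₀) := ⟨_, rfl⟩
  obtain ⟨μ, hμ⟩ : ∃ μ : ℝ, μ = (η₀ / 2) ^ 3 * (a * (a ^ 3 * V₁)) := ⟨_, rfl⟩
  have ha0 : 0 < a := by rw [ha]; positivity
  have ha1 : a ≤ 1 := by
    rw [ha, div_le_one (by positivity)]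
    have h1 : ε ^ 2 ≤ 1 := pow_le_one₀ hε.le hε1
    calc η₀ * ε ^ 2 ≤ 1 * 1 := mul_le_mul hη₀1 h1 (by positivity) zero_le_one
      _ ≤ 4 * D₀ := by linarith
  have hμ0 : 0 < μ := by rw [hμ]; positivity
  obtain ⟨ρ, hρ⟩ : ∃ ρ : ℝ, ρ = (21 * L₀ * (B + 1) / (ε * μ)) ^ 2 + L₀ + 2 := ⟨_, rfl⟩
  have hρL : L₀ + 2 ≤ ρ := by
    have := sq_nonneg (21 * L₀ * (B + 1) / (ε * μ)); rw [hρ]; linarith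
  have hρ1 : 1 ≤ ρ := by linarith
  have hρ0 : 0 < ρ := by linarith
  obtain ⟨hLx, hLt⟩ := hLip ε hε hε1
  -- THE KEY INEQUALITY `(L₀ + 2a)·B·(1 + log R + log(2/ε)) < μρ`
  have hkey : (L₀ + 2 * a) * (B * (1 + Real.log (2 * ρ + L₀ + a + 1) + Real.log (2 / ε))) < μ * ρ := by
    have hsρ : 1 ≤ Real.sqrt ρ := by
      rw [show (1 : ℝ) = Real.sqrt 1 by simp]; exact Real.sqrt_le_sqrt hρ1
    -- `1 + log R + log(2/ε) ≤ 7 √ρ / ε`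
    have hlogR : Real.log (2 * ρ + L₀ + a + 1) ≤ 4 * Real.sqrt ρ := by
      -- `log x ≤ 2√x` (as `Literature…SelbergSymmetry.log_le_two_mul_sqrt`; three lines, not worth the import)
      have hlog2 : ∀ x : ℝ, 0 < x → Real.log x ≤ 2 * Real.sqrt x := fun x hx => by
        have e1 : Real.log x = 2 * Real.log (Real.sqrt x) := by rw [Real.log_sqrt hx.le]; ring
        have e2 := Real.log_le_sub_one_of_pos (Real.sqrt_pos.mpr hx)
        linarith
      refine (hlog2 _ (by linarith)).trans ?_
      have h3 : Real.sqrt (2 * ρ + L₀ + a + 1) ≤ Real.sqrt (4 * ρ) := Real.sqrt_le_sqrt (by linarith)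
      have h4 : Real.sqrt (4 * ρ) = 2 * Real.sqrt ρ := by
        rw [Real.sqrt_mul (by norm_num), show (4 : ℝ) = 2 ^ 2 by norm_num, Real.sqrt_sq (by norm_num)]
      linarith
    have hlogε : Real.log (2 / ε) * ε ≤ 2 := by
      have h1 : Real.log (2 / ε) ≤ 2 / ε := by
        have := Real.log_le_sub_one_of_pos (show 0 < 2 / ε by positivity); linarith
      have := mul_le_mul_of_nonneg_right h1 hε.le
      rwa [div_mul_cancel₀ _ hε.ne'] at this
    have hsum : 1 + Real.log (2 * ρ + L₀ + a + 1) + Real.log (2 / ε) ≤ 7 * Real.sqrt ρ / ε := by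
      rw [le_div_iff₀ hε]
      have e1 : Real.log (2 * ρ + L₀ + a + 1) * ε ≤ 4 * Real.sqrt ρ * ε :=
        mul_le_mul_of_nonneg_right hlogR hε.le
      have e2 : 4 * Real.sqrt ρ * ε ≤ 4 * Real.sqrt ρ * (1 / 2) :=
        mul_le_mul_of_nonneg_left hε2 (by positivity)
      have e3 : (1 + Real.log (2 * ρ + L₀ + a + 1) + Real.log (2 / ε)) * ε =
          ε + Real.log (2 * ρ + L₀ + a + 1) * ε + Real.log (2 / ε) * ε := by ring
      rw [e3]
      linarith
    -- `LHS ≤ 3L₀ · B · 7√ρ/ε`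
    have hlhs : (L₀ + 2 * a) * (B * (1 + Real.log (2 * ρ + L₀ + a + 1) + Real.log (2 / ε))) ≤
        3 * L₀ * (B * (7 * Real.sqrt ρ / ε)) := by
      have hB' : B * (1 + Real.log (2 * ρ + L₀ + a + 1) + Real.log (2 / ε)) ≤
          B * (7 * Real.sqrt ρ / ε) := mul_le_mul_of_nonneg_left hsum hB
      have hsum0 : 0 ≤ 1 + Real.log (2 * ρ + L₀ + a + 1) + Real.log (2 / ε) := by
        have h1 : 0 ≤ Real.log (2 * ρ + L₀ + a + 1) := Real.log_nonneg (by linarith)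
        have h2 : 0 ≤ Real.log (2 / ε) := Real.log_nonneg (by rw [le_div_iff₀ hε]; linarith)
        linarith
      exact mul_le_mul (by linarith) hB' (mul_nonneg hB hsum0) (by positivity)
    -- `21 L₀ B/(εμ) < √ρ`, whence `3L₀·B·7√ρ/ε = (21 L₀ B/(εμ))·μ√ρ < √ρ·μ√ρ = μρ`
    have hsq : 21 * L₀ * (B + 1) / (ε * μ) ≤ Real.sqrt ρ := by
      have h1 : Real.sqrt ((21 * L₀ * (B + 1) / (ε * μ)) ^ 2) ≤ Real.sqrt ρ :=
        Real.sqrt_le_sqrt (by rw [hρ]; linarith)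
      rwa [Real.sqrt_sq (by positivity)] at h1
    have hstrict : 21 * L₀ * B / (ε * μ) < Real.sqrt ρ := by
      refine lt_of_lt_of_le ?_ hsq
      rw [div_lt_div_iff_of_pos_right (by positivity)]
      have e1 : 21 * L₀ * (B + 1) = 21 * L₀ * B + 21 * L₀ := by ring
      rw [e1]
      linarith
    have hfin : 3 * L₀ * (B * (7 * Real.sqrt ρ / ε)) < μ * ρ := by
      have h1 : 3 * L₀ * (B * (7 * Real.sqrt ρ / ε)) =
          (21 * L₀ * B / (ε * μ)) * (μ * Real.sqrt ρ) := by
        field_simp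
        ring
      have h2 : μ * ρ = Real.sqrt ρ * (μ * Real.sqrt ρ) := by
        rw [mul_comm (Real.sqrt ρ), mul_assoc, Real.mul_self_sqrt hρ0.le]
      rw [h1, h2]
      exact mul_lt_mul_of_pos_right hstrict (by positivity)
    exact lt_of_le_of_lt hlhs hfin
  -- the quiet collar at quietness `η₀`, width `L₀` (§5)
  obtain ⟨r, hρr, hr2ρ, hquiet⟩ := exists_quietCollar_of_key (ε := ε) (η := η₀) (L := L₀) (ρ := ρ)
    (a := a) (μ := μ) hv hbudB hD₀ hε hε2 hη₀0 hη₀1 hL₀1 hρL hLx hLt ha (by rw [hμ, hV₁]) hkey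
  refine ⟨r, by linarith, ?_, fun s hs x hx1 hx2 => (hquiet s hs x hx1 (by linarith)).trans ?_⟩
  · -- `r + Lq ≤ 3ρ ≤ K₁ ε^{-κ₁}`
    obtain ⟨P, hPdef⟩ : ∃ P : ℝ, P = t ^ 16 * ε ^ 18 := ⟨_, rfl⟩
    have hP : ε ^ (-(16 * k + 18)) = P⁻¹ := by
      rw [Real.rpow_neg hε.le, Real.rpow_add hε, mul_comm (16 : ℝ) k, Real.rpow_mul hε.le, ← ht,
        show (16 : ℝ) = ((16 : ℕ) : ℝ) by norm_num, show (18 : ℝ) = ((18 : ℕ) : ℝ) by norm_num,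
        Real.rpow_natCast, Real.rpow_natCast, hPdef]
    have hP0 : 0 < P := by rw [hPdef]; positivity
    have hP1 : P ≤ 1 := by
      rw [hPdef]
      exact mul_le_one₀ (pow_le_one₀ ht0.le ht1) (by positivity) (pow_le_one₀ hε.le hε1)
    have hPt : P ≤ t := by
      rw [hPdef]
      have h1 : t ^ 16 ≤ t := by
        calc t ^ 16 = t * t ^ 15 := by ring
          _ ≤ t * 1 := mul_le_mul_of_nonneg_left (pow_le_one₀ ht0.le ht1) ht0.le
          _ = t := mul_one t
      have h2 : ε ^ 18 ≤ 1 := pow_le_one₀ hε.le hε1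
      calc t ^ 16 * ε ^ 18 ≤ t * 1 := mul_le_mul h1 h2 (by positivity) ht0.le
        _ = t := mul_one t
    -- `(21 L₀ (B+1)/(εμ))² = C₀²/P` and `ρ ≤ (C₀² + K + 2)/P`
    have hsqterm : (21 * L₀ * (B + 1) / (ε * μ)) ^ 2 = C₀ ^ 2 / P := by
      have h1 : 21 * L₀ * (B + 1) / (ε * μ) = C₀ / (t ^ 8 * ε ^ 9) := by
        rw [hμ, ha, hη₀, hL₀, hC₀]
        field_simp
        ring
      rw [h1, div_pow, hPdef]
      ring
    have hρP : ρ ≤ (C₀ ^ 2 + K + 2) / P := by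
      rw [le_div_iff₀ hP0, hρ, hsqterm]
      have e1 : (C₀ ^ 2 / P + L₀ + 2) * P = C₀ ^ 2 + L₀ * P + 2 * P := by
        field_simp
      have e2 : L₀ * P ≤ K := by
        rw [hL₀, div_mul_eq_mul_div, div_le_iff₀ ht0]
        exact mul_le_mul_of_nonneg_left hPt hK0.le
      rw [e1]
      linarith
    calc r + Lq ≤ 2 * ρ + L₀ := by linarith
      _ ≤ 3 * ((C₀ ^ 2 + K + 2) / P) := by linarith
      _ = 3 * (C₀ ^ 2 + K + 2) * ε ^ (-(16 * k + 18)) := by rw [hP]; ring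
  · -- `η₀ ≤ ηq`
    rw [hη₀, ht]; exact hηq

end Summit.NavierStokesRegularity.NavierStokesRegularity.Cruxes.TypeIQuantSubcubicExp.QuietCollar

end
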